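import Mathlib

/-!
# SoloInformedReducibilityGenerators — the commutative algebra of G3 (solo-Langlands-informed, Part II §7.8)

In a generalised matrix algebra `E = (A B; C A)` over a local ring `R` the REDUCIBILITY IDEAL is
`J = image (m : B ⊗ C → R)` (Bellaïche–Chenevier; Wake–Wang-Erickson, arXiv:1707.01896 §2).
Proposition G3 of Part II §7.8 of the solo-informed programme says: if the residual multiplicities
are `dim_k B/𝔪B = r` and `dim_k C/𝔪C = s`, then `J` needs at most `rs` generators; in the RANK-ONE
regime `r = s = 1` (all ten fully open pairs of Conjecture N♯ below `|d_F| = 5000`) `J` is PRINCIPAL —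
the step of Wake–Wang-Erickson, Duke Math. J. 169, Thm 6.1.2, transported to level one over
`Spec O_F`.  This file is the kernel-checked algebra behind that step:

* `soloInformed_range_eq_span_of_span_eq_top`: over any commutative ring, if `f`, `g` span `B`, `C`
  then the image of ANY linear `m : B ⊗ C → P` is spanned by the `m (f i ⊗ g j)`;
* `soloInformed_range_eq_span_of_residue_bases`: over a LOCAL ring, bases of `k ⊗ B`, `k ⊗ C`
  (residue field `k`) lift (Nakayama, `IsLocalRing.span_eq_top_of_tmul_eq_basis`) and the image of
  `m` is spanned by a family indexed by the product of the two index types;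
* `soloInformed_reducibilityIdeal_isPrincipal`: if `dim_k (k ⊗ B) = dim_k (k ⊗ C) = 1` the image
  of `m` is a principal submodule.

The identification of `(B, C, m)` with the level-one flat pseudodeformation GMA of `𝟙 ⊕ ω` is not
formalised (see `paper/EtaleDirection.md` §7.8, CLAIMS c71).
-/

namespace Summit.Langlands.Langlands.Theorems

open Module TensorProduct

variable {R : Type*} [CommRing R] {B C P : Type*} [AddCommGroup B] [Module R B]
  [AddCommGroup C] [Module R C] [AddCommGroup P] [Module R P]

/-- If `f` spans `B` and `g` spans `C`, the image of a linear map `m : B ⊗ C → P` is spanned by the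
values `m (f i ⊗ g j)`. -/
theorem soloInformed_range_eq_span_of_span_eq_top {ι κ : Type*} (f : ι → B) (g : κ → C)
    (hf : Submodule.span R (Set.range f) = ⊤) (hg : Submodule.span R (Set.range g) = ⊤)
    (m : B ⊗[R] C →ₗ[R] P) :
    LinearMap.range m =
      Submodule.span R (Set.range fun p : ι × κ => m (f p.1 ⊗ₜ[R] g p.2)) := by
  classical
  have hF : Function.Surjective (Finsupp.linearCombination R f) := by
    rw [← LinearMap.range_eq_top, Finsupp.range_linearCombination, hf]
  have hG : Function.Surjective (Finsupp.linearCombination R g) := by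
    rw [← LinearMap.range_eq_top, Finsupp.range_linearCombination, hg]
  have hFG : Function.Surjective
      (TensorProduct.map (Finsupp.linearCombination R f) (Finsupp.linearCombination R g)) :=
    TensorProduct.map_surjective hF hG
  set T : (ι × κ →₀ R) →ₗ[R] B ⊗[R] C :=
    (TensorProduct.map (Finsupp.linearCombination R f) (Finsupp.linearCombination R g)) ∘ₗ
      (finsuppTensorFinsupp' R ι κ).symm.toLinearMap with hTdef
  have hT : Function.Surjective T := hFG.comp (finsuppTensorFinsupp' R ι κ).symm.surjective
  have h1 : LinearMap.range m = LinearMap.range (m ∘ₗ T) := by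
    rw [LinearMap.range_comp_of_range_eq_top _ (LinearMap.range_eq_top.2 hT)]
  have h2 : m ∘ₗ T = Finsupp.linearCombination R (fun p : ι × κ => m (f p.1 ⊗ₜ[R] g p.2)) := by
    apply Finsupp.lhom_ext'
    intro p
    apply LinearMap.ext_ring
    simp only [LinearMap.coe_comp, Function.comp_apply, Finsupp.lsingle_apply,
      Finsupp.linearCombination_single, one_smul, hTdef, LinearEquiv.coe_coe,
      finsuppTensorFinsupp'_symm_single_eq_single_one_tmul, TensorProduct.map_tmul]
  rw [h1, h2, Finsupp.range_linearCombination]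

variable [IsLocalRing R]

local notation "k" => IsLocalRing.ResidueField R

/-- **Nakayama form (G3).** Over a local ring `R` with residue field `k`, if `k ⊗ B` and `k ⊗ C`
have bases indexed by `ι`, `κ`, then the image of any linear `m : B ⊗ C → P` is spanned by a family
indexed by `ι × κ` (so it needs at most `#ι · #κ` generators). -/
theorem soloInformed_range_eq_span_of_residue_bases [Module.Finite R B] [Module.Finite R C]
    {ι κ : Type*} (b : Basis ι k (k ⊗[R] B)) (c : Basis κ k (k ⊗[R] C))
    (m : B ⊗[R] C →ₗ[R] P) :
    ∃ v : ι × κ → P, (∀ p, v p ∈ LinearMap.range m) ∧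
      LinearMap.range m = Submodule.span R (Set.range v) := by
  -- lift the residue bases (the map `x ↦ 1 ⊗ x` is onto `k ⊗ _` because `R → k` is onto)
  have hsB : Function.Surjective (TensorProduct.mk R (k) B 1) :=
    TensorProduct.mk_surjective _ _ _ IsLocalRing.residue_surjective
  have hsC : Function.Surjective (TensorProduct.mk R (k) C 1) :=
    TensorProduct.mk_surjective _ _ _ IsLocalRing.residue_surjective
  choose f hf using fun i => hsB (b i)
  choose g hg using fun j => hsC (c j)
  have hfspan : Submodule.span R (Set.range f) = ⊤ :=
    IsLocalRing.span_eq_top_of_tmul_eq_basis f b hf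
  have hgspan : Submodule.span R (Set.range g) = ⊤ :=
    IsLocalRing.span_eq_top_of_tmul_eq_basis g c hg
  refine ⟨fun p => m (f p.1 ⊗ₜ[R] g p.2), fun p => LinearMap.mem_range_self m _, ?_⟩
  exact soloInformed_range_eq_span_of_span_eq_top f g hfspan hgspan m

/-- **Rank-one regime: the reducibility ideal is principal.** If `dim_k (k ⊗ B) = dim_k (k ⊗ C) = 1`
then the image of `m : B ⊗ C → P` is a principal submodule (for `P = R`: a principal ideal). -/
theorem soloInformed_reducibilityIdeal_isPrincipal [Module.Finite R B] [Module.Finite R C]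
    (hB : finrank k (k ⊗[R] B) = 1) (hC : finrank k (k ⊗[R] C) = 1)
    (m : B ⊗[R] C →ₗ[R] P) : (LinearMap.range m).IsPrincipal := by
  obtain ⟨v, -, hv⟩ := soloInformed_range_eq_span_of_residue_bases
    (Module.finBasisOfFinrankEq k (k ⊗[R] B) hB) (Module.finBasisOfFinrankEq k (k ⊗[R] C) hC) m
  refine ⟨⟨v (0, 0), ?_⟩⟩
  rw [hv]
  congr 1
  ext x
  constructor
  · rintro ⟨⟨i, j⟩, rfl⟩
    fin_cases i; fin_cases j
    exact Set.mem_singleton _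
  · intro hx
    rw [Set.mem_singleton_iff] at hx
    subst hx
    exact ⟨(0, 0), rfl⟩

end Summit.Langlands.Langlands.Theorems
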